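/-
Copyright: rh-split cell (screw, bridge) gen 15, 2026-08-27.  Splitting search over kernel-typed
RH-equivalences.  A splitting `A ∧ B ⟹ RH` is CONDITIONAL bookkeeping unless `A` and `B` are both
proved; nothing here bears on the truth of RH.
-/
import Summits.RiemannHypothesis.RiemannHypothesis.Theorems.Splittings.ScrewBorelFluxB
import Summits.RiemannHypothesis.RiemannHypothesis.Theorems.Splittings.ScrewLatticeContinuationB
import HarnessLib

/-!
# Row X-10 — `CEIL(h) ∧ TW(h) ⟺ RH`: the lattice generating function of Suzuki's screw function
sees through every aliased pole wall of ZERO LENGTH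

Objects of `ScrewLatticeContinuation` (row X-9): step `h > 0`, multipliers `u_ρ = e^{(ρ-1/2)h}`,
coefficients `c_ρ = m(ρ)/(ρ-1/2)²` (`Re c_ρ < 0`, `∑ ‖c_ρ‖ < ∞`), the lattice generating function
`P_h(z) = ∑_k Ψ(k h) z^k` (`latticeGF`), which for `‖z‖ < e^{-h/2}` IS the Borel series of the data
(`latticeGF_eq_borel`, Suzuki 2023 Thm 1.1 (2)), and the ALIASED POLE FIELD `aliasedPoleSet h =
{e^{∓(ρ-1/2)h}} ∩ 𝔻` (empty iff RH) with closure `T_h`.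

* `CEIL(h)` (`LatticeCeiling h`, X-9): `|Ψ(k h)| ≤ K_ε e^{ε k}` — `P_h` is holomorphic on `𝔻`.
* `TW(h)` (`ThinWall h`, NEW): `μH[1] (T_h ∩ 𝔻) = 0` — the closure of the aliased pole field has ZERO
  LENGTH (one-dimensional Hausdorff measure zero) inside the disc.  RH-implied (the field is empty);
  implied by `CC(h)` of row X-9 (countable sets are `μH[1]`-null), by `dimH (T_h ∩ 𝔻) < 1`, by the
  eventual strip `ES`, by `FOZ`.

**Row X-10** (`latticeCeiling_and_thinWall_iff_rh`): `CEIL(h) ∧ TW(h) ⟺ RH` for every `h > 0`, by the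
ζ-free theorem `ScrewBorelFlux.poleSet_eq_empty_of_hausdorffMeasure_zero` (flux of the Borel series
through three «good circles» whose radii avoid the Lipschitz shadows of the null set `T_h ∩ 𝔻`).  Since
`CC(h) ⟹ TW(h)`, X-10 implies X-9 formally and replaces the countability/Baire mechanism of X-9 by a
METRIC one.  RH-free content (`latticeCeiling_dichotomy_length`, `…_dimH`): **`CEIL(h) ⟹ RH ∨ (T_h ∩ 𝔻 has
positive length)`**, in particular `RH ∨ dimH (T_h ∩ 𝔻) ≥ 1` — a blinding wall of aliased zeros must be at
least a CURVE'S WORTH of zeros.  The threshold is LENGTH, not AREA: the blind Wolff configuration of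
barrier B16 (`ScrewLatticeWolffModel.exists_blind_model`, real-weight class) has an AREA-NULL wall (centres
of an a.e. disc packing accumulate only on the residual set and on the packing circles) which nevertheless
blinds the lattice — consistently with the dichotomy, that wall contains circles and so has positive length
(`ScrewBorelFlux.hausdorffMeasure_sphere_pos`).  Whether a blinding wall of σ-finite length / dimension
exactly `1` exists in the sign-definite class is open.

§4 is the RH-free CIRCLES THEOREM on the ζ-side (`not_small_circles_of_latticeCeiling`): under `CEIL(h)`
no aliased pole is encircled by arbitrarily small circles of `𝔻 ∖ T_h` linked to the origin inside
`𝔻 ∖ T_h`; and the FLUX QUANTISATION `tsum_discWeight_eq_zero_of_latticeCeiling`: every such circle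
encloses total charge `∑ (c_ρ/2)·q = 0` over the enclosed aliased poles `q` — with no hypothesis on the wall.

No `sorry`, no new axioms, no instances, no notation.
-/

set_option linter.dupNamespace false

namespace Summit.RiemannHypothesis.RiemannHypothesis.Theorems.Splittings.ScrewLatticeThinWall

open Complex Filter Topology Set Metric MeasureTheory
open scoped ENNReal
open Literature.NumberTheory.LFunctions
open ZetaZeros.riemannZetaNontrivialZeros
open Summit.RiemannHypothesis.RiemannHypothesis.Theorems.Splittings
open Summit.RiemannHypothesis.RiemannHypothesis.Theorems.Splittings.ScrewBorel
open Summit.RiemannHypothesis.RiemannHypothesis.Theorems.Splittings.ScrewBorelFlux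
open Summit.RiemannHypothesis.RiemannHypothesis.Theorems.Splittings.ScrewLatticeContinuation

/-! ## 1. The thin-wall hypothesis `TW(h)` -/

/-- `TW(h)`: the closure of the aliased pole field `{e^{∓(ρ-1/2)h}} ∩ 𝔻` has ZERO LENGTH inside the unit
disc (`μH[1] = 0`).  Open; RH-implied (`thinWall_of_rh`); implied by `CC(h)` (`thinWall_of_countableClosure`). -/
@[conjecture] def ThinWall (h : ℝ) : Prop :=
  μH[1] (closure (aliasedPoleSet h) ∩ ball (0 : ℂ) 1) = 0

/-- **`CC(h) ⟹ TW(h)`**: countable sets have zero length. -/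
theorem thinWall_of_countableClosure {h : ℝ} (hcc : CountableClosure h) : ThinWall h :=
  hausdorffMeasure_zero_of_countable hcc

/-- `dimH (T_h ∩ 𝔻) < 1 ⟹ TW(h)`. -/
theorem thinWall_of_dimH_lt_one {h : ℝ} (hdim : dimH (closure (aliasedPoleSet h) ∩ ball (0 : ℂ) 1) < 1) :
    ThinWall h :=
  hausdorffMeasure_zero_of_dimH_lt_one hdim

/-- **RH ⟹ TW(h)** (the aliased pole field is empty under RH). -/
theorem thinWall_of_rh (hRH : RiemannHypothesis) (h : ℝ) : ThinWall h :=
  thinWall_of_countableClosure (countableClosure_of_rh hRH h)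

/-! ## 2. Row X-10 and the dichotomy -/

/-- **`CEIL(h) ∧ TW(h) ⟹` the aliased pole field is empty** (`h > 0`; the ζ-free flux theorem applied to
Suzuki's data). -/
theorem aliasedPoleSet_eq_empty_of_latticeCeiling_of_thinWall {h : ℝ} (hh : 0 < h)
    (hceil : LatticeCeiling h) (htw : ThinWall h) : aliasedPoleSet h = ∅ :=
  poleSet_eq_empty_of_hausdorffMeasure_zero (c := coeff) (u := mult h) summable_norm_coeff re_coeff_neg
    (mult_ne_zero h) (differentiableOn_latticeGF hceil) (Real.exp_pos (-(h / 2)))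
    (fun _ hp ↦ exp_neg_half_le_norm_of_mem hh.le hp)
    (fun _ hz ↦ latticeGF_eq_borel hh (mem_ball_zero_iff.1 hz)) htw

/-- **`CEIL(h) ∧ TW(h) ⟹ RH`** (`h > 0`). -/
theorem rh_of_latticeCeiling_of_thinWall {h : ℝ} (hh : 0 < h) (hceil : LatticeCeiling h)
    (htw : ThinWall h) : RiemannHypothesis := by
  by_contra hnot
  have hne := aliasedPoleSet_nonempty_of_not_rh hh hnot
  rw [aliasedPoleSet_eq_empty_of_latticeCeiling_of_thinWall hh hceil htw] at hne
  exact Set.not_nonempty_empty hne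

/-- **ROW X-10 (the splitting)**, `h > 0` arbitrary: `CEIL(h) ∧ TW(h) ↔ RiemannHypothesis`.  (X-10 contains
row X-9 `ScrewLatticeContinuation.latticeCeiling_and_countableClosure_iff_rh` through
`thinWall_of_countableClosure`.) -/
theorem latticeCeiling_and_thinWall_iff_rh {h : ℝ} (hh : 0 < h) :
    (LatticeCeiling h ∧ ThinWall h) ↔ RiemannHypothesis :=
  ⟨fun hab ↦ rh_of_latticeCeiling_of_thinWall hh hab.1 hab.2,
    fun hRH ↦ ⟨latticeCeiling_of_rh hRH h, thinWall_of_rh hRH h⟩⟩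

/-- **THE DICHOTOMY (RH-free content)**, `h > 0`: if the lattice samples `Ψ(k h)` grow sub-exponentially,
then EITHER the Riemann hypothesis holds OR the closure of the aliased pole field has POSITIVE LENGTH
inside the unit disc. -/
theorem latticeCeiling_dichotomy_length {h : ℝ} (hh : 0 < h) (hceil : LatticeCeiling h) :
    RiemannHypothesis ∨ 0 < μH[1] (closure (aliasedPoleSet h) ∩ ball (0 : ℂ) 1) := by
  by_cases htw : ThinWall h
  · exact Or.inl (rh_of_latticeCeiling_of_thinWall hh hceil htw)
  · exact Or.inr (pos_iff_ne_zero.2 htw)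

/-- Dimension form: `CEIL(h) ⟹ RH ∨ dimH (T_h ∩ 𝔻) ≥ 1` — a blinding wall is at least a curve's worth of
aliased zeros. -/
theorem latticeCeiling_dichotomy_dimH {h : ℝ} (hh : 0 < h) (hceil : LatticeCeiling h) :
    RiemannHypothesis ∨ 1 ≤ dimH (closure (aliasedPoleSet h) ∩ ball (0 : ℂ) 1) := by
  by_cases hdim : dimH (closure (aliasedPoleSet h) ∩ ball (0 : ℂ) 1) < 1
  · exact Or.inl (rh_of_latticeCeiling_of_thinWall hh hceil (thinWall_of_dimH_lt_one hdim))
  · exact Or.inr (not_lt.1 hdim)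

/-! ## 3. Companions: `LPSD(h) ∧ TW(h)`, bounded `∧ TW(h)`, `ES ⟹ TW(h)`, `FOZ ⟹ TW(h)` -/

/-- **`LPSD(h) ∧ TW(h) ↔ RH`** (`h > 0`). -/
theorem latticePSD_and_thinWall_iff_rh {h : ℝ} (hh : 0 < h) :
    ((∀ (N : ℕ) (t x : Fin N → ℝ), (∀ i, t i ∈ Set.range fun k : ℕ ↦ (k : ℝ) * h) →
        0 ≤ ∑ i, ∑ j, zetaScrewKernel (t i) (t j) * (x i * x j)) ∧ ThinWall h) ↔
      RiemannHypothesis :=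
  ⟨fun hab ↦ rh_of_latticeCeiling_of_thinWall hh (latticeCeiling_of_latticePSD hab.1) hab.2,
    fun hRH ↦ ⟨ScrewLatticePSD.latticeForm_nonneg_of_rh hRH h, thinWall_of_rh hRH h⟩⟩

/-- Bounded lattice samples `∧ TW(h) ↔ RH` (`h > 0`). -/
theorem latticeBounded_and_thinWall_iff_rh {h : ℝ} (hh : 0 < h) :
    ((∃ K : ℝ, ∀ k : ℕ, |zetaScrew (k * h)| ≤ K) ∧ ThinWall h) ↔ RiemannHypothesis :=
  ⟨fun hab ↦ rh_of_latticeCeiling_of_thinWall hh (latticeCeiling_of_bounded hab.1) hab.2,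
    fun hRH ↦ ⟨⟨_, fun k ↦ ZetaScrewGrowth.abs_zetaScrew_le_of_RH hRH (k * h)⟩, thinWall_of_rh hRH h⟩⟩

/-- `ES ⟹ TW(h)` (`h > 0`). -/
theorem thinWall_of_eventualStrip {h : ℝ} (hh : 0 < h)
    (hES : ∀ η : ℝ, 0 < η →
      {ρ : ℂ | ρ ∈ ZetaZeros.riemannZetaNontrivialZeros ∧ η ≤ |ρ.re - 1 / 2|}.Finite) :
    ThinWall h :=
  thinWall_of_countableClosure (countableClosure_of_eventualStrip hh hES)

/-- `FOZ ⟹ TW(h)`. -/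
theorem thinWall_of_foz (hfoz : Theses.RuelleBand.CofiniteCriticalLine) (h : ℝ) : ThinWall h :=
  thinWall_of_countableClosure (countableClosure_of_foz hfoz h)

/-! ## 4. CIRCLES and FLUX QUANTISATION (RH-free, no hypothesis on the wall) -/

/-- **CIRCLES THEOREM** (`h > 0`, RH-free).  Under `CEIL(h)` no aliased pole `p` is encircled by
arbitrarily small circles `sphere p R` contained in preconnected sets `V ∋ 0`, `V ⊆ 𝔻 ∖ T_h`. -/
theorem not_small_circles_of_latticeCeiling {h : ℝ} (hh : 0 < h) (hceil : LatticeCeiling h)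
    {p : ℂ} (hp : p ∈ aliasedPoleSet h)
    (hcirc : ∀ δ > 0, ∃ R ∈ Ioo 0 δ, ∃ V : Set ℂ, IsPreconnected V ∧ (0 : ℂ) ∈ V ∧
      V ⊆ ball 0 1 \ closure (aliasedPoleSet h) ∧ sphere p R ⊆ V) : False :=
  false_of_small_circles (c := coeff) (u := mult h) summable_norm_coeff re_coeff_neg (mult_ne_zero h)
    (differentiableOn_latticeGF hceil) (Real.exp_pos (-(h / 2)))
    (fun _ hz ↦ latticeGF_eq_borel hh (mem_ball_zero_iff.1 hz)) hp hcirc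

/-- Positive form: under `CEIL(h)` every aliased pole `p` has a SCALE `δ > 0` below which no circle
`sphere p R` (`0 < R < δ`) lies in a preconnected `V ∋ 0` inside `𝔻 ∖ T_h` — the wall `T_h` meets, or cuts
off from the origin, every small circle around `p`. -/
theorem exists_scale_of_latticeCeiling {h : ℝ} (hh : 0 < h) (hceil : LatticeCeiling h)
    {p : ℂ} (hp : p ∈ aliasedPoleSet h) :
    ∃ δ > 0, ∀ R ∈ Ioo 0 δ, ∀ V : Set ℂ, IsPreconnected V → (0 : ℂ) ∈ V →
      V ⊆ ball 0 1 \ closure (aliasedPoleSet h) → ¬ sphere p R ⊆ V := by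
  by_contra hno
  push Not at hno
  refine not_small_circles_of_latticeCeiling hh hceil hp fun δ hδ ↦ ?_
  obtain ⟨R, hR, V, hV, hV0, hVs, hS⟩ := hno δ hδ
  exact ⟨R, hR, V, hV, hV0, hVs, hS⟩

/-- **FLUX QUANTISATION** (`h > 0`, RH-free, no hypothesis on the wall).  Under `CEIL(h)`, a circle
`sphere p R` (`0 < R ≤ (1 - ‖p‖)/2`) contained in a preconnected `V ∋ 0` inside `𝔻 ∖ T_h` encloses total
charge zero: `∑_ρ discWeight c_ρ u_ρ p R = ∑_{q enclosed} (c_ρ/2)·q = 0`. -/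
theorem tsum_discWeight_eq_zero_of_latticeCeiling {h : ℝ} (hh : 0 < h) (hceil : LatticeCeiling h)
    {p : ℂ} {R : ℝ} (hR : 0 < R) (hRp : R ≤ (1 - ‖p‖) / 2) {V : Set ℂ} (hV : IsPreconnected V)
    (hV0 : (0 : ℂ) ∈ V) (hVsub : V ⊆ ball 0 1 \ closure (aliasedPoleSet h)) (hSV : sphere p R ⊆ V) :
    ∑' ρ : ZetaZeros.riemannZetaNontrivialZeros, discWeight (coeff ρ) (mult h ρ) p R = 0 := by
  haveI : Countable ZetaZeros.riemannZetaNontrivialZeros :=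
    countable_of_summable_of_re_neg summable_norm_coeff re_coeff_neg
  exact tsum_discWeight_eq_zero (c := coeff) (u := mult h) summable_norm_coeff (mult_ne_zero h)
    (differentiableOn_latticeGF hceil) (Real.exp_pos (-(h / 2)))
    (fun _ hz ↦ latticeGF_eq_borel hh (mem_ball_zero_iff.1 hz)) hR hRp hV hV0 hVsub hSV

end Summit.RiemannHypothesis.RiemannHypothesis.Theorems.Splittings.ScrewLatticeThinWall
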